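import Mathlib
import Summits.Ventures.PercRepro2.Defs
import Summits.Ventures.PercRepro2.Independence
import Summits.Ventures.PercRepro2.Harris
import Summits.Ventures.PercRepro2.Graph
import Summits.Ventures.PercRepro2.Exploration
import Summits.Ventures.PercRepro2.Events
import Summits.Ventures.PercRepro2.Induced
import Summits.Ventures.PercRepro2.BHK
import Summits.Ventures.PercRepro2.BHKEvents
import Summits.Ventures.PercRepro2.OneEdge
import Summits.Ventures.PercRepro2.RBRoot
import Summits.Ventures.PercRepro2.RBRootEdge
import Summits.Ventures.PercRepro2.RBRootEdgePin
import Summits.Ventures.PercRepro2.RBRootEdgeMain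

/-!
# Row 2′RB: removing the edge to the OTHER root (mine-a g5; MINE-A.md §31, mirror edge)

`RBRootEdgeMain` removes an edge `e = {w, s}` for both forms of the row at `w`. For the edge
`e = {w, t}` to the other root, the cross form `({b ↔ s}, {o ↔ t})` is `cross_of_update` with the
roots renamed (the Rao–Blackwell sum is symmetric in its two events and `Q` in the roots), so only
the same form `({b ↔ s}, {o ↔ s})` is new: the within term under `p[e ↦ 1]` is the B-frame atom
`RBRoot.same_at_t` (the cluster of `w` is the cluster of `t`), and the coarse term has
`μ₁(bL) ≤ μ₀(bL)`, `μ₁(oL) ≤ μ₀(oL)` (BHK 1.3 for the cluster of `s` against `{w ∉ C_s}`), a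
product of two nonpositive differences. With `RBRootEdgeMain`: every edge between the third
vertex and a root can be removed, for both forms — 2′RB is equivalent to its restriction to third
vertices with no edge to a root.
-/

namespace Summit.Ventures.PercRepro2

namespace RBRootEdge

open scoped Classical

section TEdge

variable {V : Type*} {E : Type*} [Fintype E] [DecidableEq E] [Fintype V] {R : Type*} [Field R]
  [LinearOrder R] [IsStrictOrderedRing R] (p : E → R) (ends : E → Sym2 V) (s t w : V) {e : E}

omit [Fintype E] [Fintype V] [Field R] [LinearOrder R] [IsStrictOrderedRing R] in
/-- Forcing `e = {w, t}` open on `{s ↮ t} ∩ {w ↮ s}`, `{b ↔ s}` is unchanged. -/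
lemma force_mem_connEvent_root_t {b : V} (hends : ends e = s(w, t)) (ω : Config E)
    (hQ : ω ∈ (connEvent ends s t)ᶜ) (hw : ω ∈ (connEvent ends w s)ᶜ) :
    Function.update ω e true ∈ connEvent ends b s ↔ ω ∈ connEvent ends b s := by
  simp only [mem_connEvent, conn_force_iff hends]
  constructor
  · rintro (h | ⟨_, h⟩ | ⟨_, h⟩)
    · exact h
    · exact absurd (conn_symm h) hQ
    · exact absurd h hw
  · exact fun h => Or.inl h

/-- **Affinity of the atom term, same version, edge at `t`** (`e = {w, t}`). -/
lemma term_pin_same_t {p : E → R} (hp : IsProbVec p) (hends : ends e = s(w, t)) (o b : V)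
    (A : Set V) :
    prob p ((connEvent ends s t)ᶜ ∩ clusterEvent ends w A ∩ connEvent ends b s) *
        prob p ((connEvent ends s t)ᶜ ∩ clusterEvent ends w A ∩ connEvent ends o s) /
      prob p ((connEvent ends s t)ᶜ ∩ clusterEvent ends w A) =
    p e * (prob (Function.update p e 1) ((connEvent ends s t)ᶜ ∩ clusterEvent ends w A ∩
            connEvent ends b s) *
          prob (Function.update p e 1) ((connEvent ends s t)ᶜ ∩ clusterEvent ends w A ∩
            connEvent ends o s) /
        prob (Function.update p e 1) ((connEvent ends s t)ᶜ ∩ clusterEvent ends w A)) +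
      (1 - p e) * (prob (Function.update p e 0) ((connEvent ends s t)ᶜ ∩ clusterEvent ends w A ∩
            connEvent ends b s) *
          prob (Function.update p e 0) ((connEvent ends s t)ᶜ ∩ clusterEvent ends w A ∩
            connEvent ends o s) /
        prob (Function.update p e 0) ((connEvent ends s t)ᶜ ∩ clusterEvent ends w A)) := by
  by_cases ht : t ∈ A
  · by_cases hs : s ∈ A
    · rw [compl_inter_atom_of_mem_mem ends s t w hs ht]
      simp
    · rw [RBRoot.compl_connEvent_comm, compl_inter_atom_of_mem_notMem ends t s w ht hs]
      have hb1 := prob_atom_inter_conn_other (Function.update p e 1) ends s w hs b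
      have hb0 := prob_atom_inter_conn_other (Function.update p e 0) ends s w hs b
      have ho1 := prob_atom_inter_conn_other (Function.update p e 1) ends s w hs o
      have ho0 := prob_atom_inter_conn_other (Function.update p e 0) ends s w hs o
      rw [kappa_update_one p ends t s w hends ht b] at hb1
      rw [kappa_update_zero p ends t s w hends ht b] at hb0
      rw [kappa_update_one p ends t s w hends ht o] at ho1
      rw [kappa_update_zero p ends t s w hends ht o] at ho0
      exact affine_of_factor (prob_eq_pin p _ e) (prob_atom_inter_conn_other p ends s w hs b) hb0 hb1
        (prob_atom_inter_conn_other p ends s w hs o) ho0 ho1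
  · have hp0 : IsProbVec (Function.update p e 0) := hp.update e le_rfl zero_le_one
    rw [Set.inter_right_comm _ _ (connEvent ends b s), Set.inter_right_comm _ _ (connEvent ends o s)]
    set d0 := prob (Function.update p e 0) ((connEvent ends s t)ᶜ ∩ clusterEvent ends w A) with hd0
    set a0 := prob (Function.update p e 0) ((connEvent ends s t)ᶜ ∩ connEvent ends b s ∩
      clusterEvent ends w A) with ha0
    set b0 := prob (Function.update p e 0) ((connEvent ends s t)ᶜ ∩ connEvent ends o s ∩
      clusterEvent ends w A) with hb0
    have ha0' : a0 = d0 * (a0 / d0) := by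
      by_cases h : d0 = 0
      · have hle : a0 ≤ d0 := prob_mono hp0 fun ω hω => ⟨hω.1.1, hω.2⟩
        rw [h] at hle
        rw [le_antisymm hle (prob_nonneg hp0 _), h]
        simp
      · rw [mul_div_cancel₀ _ h]
    have hb0' : b0 = d0 * (b0 / d0) := by
      by_cases h : d0 = 0
      · have hle : b0 ≤ d0 := prob_mono hp0 fun ω hω => ⟨hω.1.1, hω.2⟩
        rw [h] at hle
        rw [le_antisymm hle (prob_nonneg hp0 _), h]
        simp
      · rw [mul_div_cancel₀ _ h]
    refine affine_of_factor (c₁ := a0 / d0) (c₂ := b0 / d0) (prob_eq_pin p _ e) ?_ ha0' ?_ ?_ hb0' ?_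
    · rw [prob_atom_of_notMem p ends t w hends ht ((connEvent ends s t)ᶜ ∩ connEvent ends b s),
        prob_atom_of_notMem p ends t w hends ht (connEvent ends s t)ᶜ, ← ha0, ← hd0, mul_assoc,
        ← ha0']
    · rw [prob_update_one_atom_of_notMem p ends t w hends ht ((connEvent ends s t)ᶜ ∩ connEvent ends b s),
        prob_update_one_atom_of_notMem p ends t w hends ht (connEvent ends s t)ᶜ, zero_mul]
    · rw [prob_atom_of_notMem p ends t w hends ht ((connEvent ends s t)ᶜ ∩ connEvent ends o s),
        prob_atom_of_notMem p ends t w hends ht (connEvent ends s t)ᶜ, ← hb0, ← hd0, mul_assoc,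
        ← hb0']
    · rw [prob_update_one_atom_of_notMem p ends t w hends ht ((connEvent ends s t)ᶜ ∩ connEvent ends o s),
        prob_update_one_atom_of_notMem p ends t w hends ht (connEvent ends s t)ᶜ, zero_mul]

/-- **Affinity of the Rao–Blackwell sum in the weight of the edge `{w, t}`, same version.** -/
theorem rbSum_pin_same_t {p : E → R} (hp : IsProbVec p) (hends : ends e = s(w, t)) (o b : V) :
    RBRoot.rbSum p ends s t w (connEvent ends b s) (connEvent ends o s) =
      p e * RBRoot.rbSum (Function.update p e 1) ends s t w (connEvent ends b s) (connEvent ends o s) +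
        (1 - p e) * RBRoot.rbSum (Function.update p e 0) ends s t w (connEvent ends b s)
          (connEvent ends o s) := by
  unfold RBRoot.rbSum
  rw [Finset.mul_sum, Finset.mul_sum, ← Finset.sum_add_distrib]
  exact Finset.sum_congr rfl fun A _ => term_pin_same_t ends s t w hp hends o b A

omit [Fintype V] [LinearOrder R] [IsStrictOrderedRing R] in
/-- `P_{p[e↦1]}(Q) = P_{p[e↦0]}(Q ∩ {w ↮ s})` (`e = {w, t}`). -/
lemma prob_update_one_compl_t (hends : ends e = s(w, t)) :
    prob (Function.update p e 1) (connEvent ends s t)ᶜ =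
      prob (Function.update p e 0) ((connEvent ends s t)ᶜ ∩ (connEvent ends w s)ᶜ) := by
  rw [RBRoot.compl_connEvent_comm ends s t, prob_update_one_compl ends t s w hends,
    ← RBRoot.compl_connEvent_comm ends s t]

omit [Fintype V] [LinearOrder R] [IsStrictOrderedRing R] in
/-- `P_{p[e↦1]}(Q ∩ {b ↔ s}) = P_{p[e↦0]}(Q ∩ {b ↔ s} ∩ {w ↮ s})` (`e = {w, t}`). -/
lemma prob_update_one_conn_root_t (hends : ends e = s(w, t)) (b : V) :
    prob (Function.update p e 1) ((connEvent ends s t)ᶜ ∩ connEvent ends b s) =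
      prob (Function.update p e 0) ((connEvent ends s t)ᶜ ∩ connEvent ends b s ∩
        (connEvent ends w s)ᶜ) := by
  rw [← update_zero_update_one p e, prob_update_one_eq]
  congr 1
  ext ω
  simp only [Set.mem_setOf_eq, Set.mem_inter_iff]
  have hQ := force_mem_compl_connEvent (t := s) hends ω
  rw [RBRoot.compl_connEvent_comm ends s t]
  constructor
  · rintro ⟨hQ', hb⟩
    have h := hQ.1 hQ'
    exact ⟨⟨h.1, (force_mem_connEvent_root_t ends s t w hends ω
      ((RBRoot.compl_connEvent_comm ends s t).symm ▸ h.1) h.2).1 hb⟩, h.2⟩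
  · rintro ⟨⟨hQ', hb⟩, hw⟩
    exact ⟨hQ.2 ⟨hQ', hw⟩, (force_mem_connEvent_root_t ends s t w hends ω
      ((RBRoot.compl_connEvent_comm ends s t).symm ▸ hQ') hw).2 hb⟩

variable {p}

/-- **Monotonicity, edge at `t`**: `μ₁(b ↔ s) ≤ μ₀(b ↔ s)` in the cleared form
`P₁(Q ∩ bL) · P₀(Q) ≤ P₀(Q ∩ bL) · P₁(Q)` — BHK 1.3 for the cluster of `s` against `{w ∉ C_s}`. -/
lemma mono_root_t (hp : IsProbVec p) (hends : ends e = s(w, t)) (b : V) :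
    prob (Function.update p e 1) ((connEvent ends s t)ᶜ ∩ connEvent ends b s) *
        prob (Function.update p e 0) (connEvent ends s t)ᶜ ≤
      prob (Function.update p e 0) ((connEvent ends s t)ᶜ ∩ connEvent ends b s) *
        prob (Function.update p e 1) (connEvent ends s t)ᶜ := by
  have hp0 : IsProbVec (Function.update p e 0) := hp.update e le_rfl zero_le_one
  have key := bhk_same_cluster_events (Function.update p e 0) hp0 ends s t
    (RBRoot.isUpperSet_mem b) (RBRoot.isUpperSet_mem w)
  rw [← RBRoot.connEvent_eq_clusterInEvent_right ends b s,
    ← RBRoot.connEvent_eq_clusterInEvent_right ends w s] at key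
  rw [prob_update_one_compl_t p ends s t w hends, prob_update_one_conn_root_t p ends s t w hends b]
  have dA := prob_inter_add_prob_inter_compl (Function.update p e 0)
    ((connEvent ends s t)ᶜ ∩ connEvent ends b s) (connEvent ends w s)
  have dZ := prob_inter_add_prob_inter_compl (Function.update p e 0) (connEvent ends s t)ᶜ
    (connEvent ends w s)
  have e1 : connEvent ends b s ∩ connEvent ends w s ∩ (connEvent ends s t)ᶜ =
      (connEvent ends s t)ᶜ ∩ connEvent ends b s ∩ connEvent ends w s := by
    ext ω; simp only [Set.mem_inter_iff]; tauto
  have e2 : connEvent ends b s ∩ (connEvent ends s t)ᶜ =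
      (connEvent ends s t)ᶜ ∩ connEvent ends b s := Set.inter_comm _ _
  have e3 : connEvent ends w s ∩ (connEvent ends s t)ᶜ =
      (connEvent ends s t)ᶜ ∩ connEvent ends w s := Set.inter_comm _ _
  rw [e1, e2, e3] at key
  have hA' : prob (Function.update p e 0) ((connEvent ends s t)ᶜ ∩ connEvent ends b s ∩
      (connEvent ends w s)ᶜ) * prob (Function.update p e 0) (connEvent ends s t)ᶜ =
      prob (Function.update p e 0) ((connEvent ends s t)ᶜ ∩ connEvent ends b s) *
        prob (Function.update p e 0) (connEvent ends s t)ᶜ -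
      prob (Function.update p e 0) ((connEvent ends s t)ᶜ ∩ connEvent ends b s ∩ connEvent ends w s) *
        prob (Function.update p e 0) (connEvent ends s t)ᶜ := by
    rw [← dA]; ring
  have hZ' : prob (Function.update p e 0) ((connEvent ends s t)ᶜ ∩ connEvent ends b s) *
      prob (Function.update p e 0) ((connEvent ends s t)ᶜ ∩ (connEvent ends w s)ᶜ) =
      prob (Function.update p e 0) ((connEvent ends s t)ᶜ ∩ connEvent ends b s) *
        prob (Function.update p e 0) (connEvent ends s t)ᶜ -
      prob (Function.update p e 0) ((connEvent ends s t)ᶜ ∩ connEvent ends b s) *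
        prob (Function.update p e 0) ((connEvent ends s t)ᶜ ∩ connEvent ends w s) := by
    rw [← dZ]; ring
  linarith [key, hA', hZ']

omit [LinearOrder R] [IsStrictOrderedRing R] in
/-- Under `p[e ↦ 1]` (`e = {w, t}`) the Rao–Blackwell sum at `w` is the sum at the root `t`. -/
lemma rbSum_update_one_eq_t (hends : ends e = s(w, t)) (X Y : Set (Config E)) :
    RBRoot.rbSum (Function.update p e 1) ends s t w X Y =
      RBRoot.rbSum (Function.update p e 1) ends s t t X Y := by
  unfold RBRoot.rbSum
  refine Finset.sum_congr rfl fun A _ => ?_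
  rw [Set.inter_right_comm _ (clusterEvent ends w A) X, Set.inter_right_comm _ (clusterEvent ends w A) Y,
    prob_update_one_atom_eq p ends t w hends _ A, prob_update_one_atom_eq p ends t w hends _ A,
    prob_update_one_atom_eq p ends t w hends _ A,
    ← Set.inter_right_comm _ (clusterEvent ends t A) X,
    ← Set.inter_right_comm _ (clusterEvent ends t A) Y]

/-- **The edge to the other root can be removed — (RB-same).** For `e = {w, t}`, the same form
of the row at `w` under `p` follows from the same form under `p[e ↦ 0]`. -/
theorem same_of_update_t (hp : IsProbVec p) {o b : V} (hends : ends e = s(w, t))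
    (h0 : prob (Function.update p e 0) ((connEvent ends s t)ᶜ ∩ connEvent ends b s) *
        prob (Function.update p e 0) ((connEvent ends s t)ᶜ ∩ connEvent ends o s) /
        prob (Function.update p e 0) (connEvent ends s t)ᶜ ≤
      RBRoot.rbSum (Function.update p e 0) ends s t w (connEvent ends b s) (connEvent ends o s)) :
    prob p ((connEvent ends s t)ᶜ ∩ connEvent ends b s) *
        prob p ((connEvent ends s t)ᶜ ∩ connEvent ends o s) / prob p (connEvent ends s t)ᶜ ≤
      RBRoot.rbSum p ends s t w (connEvent ends b s) (connEvent ends o s) := by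
  have hp0 : IsProbVec (Function.update p e 0) := hp.update e le_rfl zero_le_one
  have hp1 : IsProbVec (Function.update p e 1) := hp.update e zero_le_one le_rfl
  have h1 : prob (Function.update p e 1) ((connEvent ends s t)ᶜ ∩ connEvent ends b s) *
      prob (Function.update p e 1) ((connEvent ends s t)ᶜ ∩ connEvent ends o s) /
      prob (Function.update p e 1) (connEvent ends s t)ᶜ ≤
      RBRoot.rbSum (Function.update p e 1) ends s t w (connEvent ends b s) (connEvent ends o s) := by
    rw [rbSum_update_one_eq_t ends s t w hends]
    exact RBRoot.same_at_t ends hp1 o b s t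
  rw [rbSum_pin_same_t ends s t w hp hends o b,
    prob_eq_pin p ((connEvent ends s t)ᶜ ∩ connEvent ends b s) e,
    prob_eq_pin p ((connEvent ends s t)ᶜ ∩ connEvent ends o s) e, prob_eq_pin p (connEvent ends s t)ᶜ e]
  have hmix := mix_same (hp.nonneg e) (hp.le_one e) (prob_nonneg hp0 _)
    (prob_mono hp0 Set.inter_subset_left) (prob_nonneg hp1 _) (prob_mono hp1 Set.inter_subset_left)
    (prob_nonneg hp0 _) (prob_mono hp0 Set.inter_subset_left) (prob_nonneg hp1 _)
    (prob_mono hp1 Set.inter_subset_left)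
    (mul_nonneg_iff.2 (Or.inr ⟨sub_nonpos.2 (mono_root_t ends s t w hp hends b),
      sub_nonpos.2 (mono_root_t ends s t w hp hends o)⟩))
  exact hmix.trans (add_le_add (mul_le_mul_of_nonneg_left h1 (hp.nonneg e))
    (mul_le_mul_of_nonneg_left h0 (sub_nonneg.2 (hp.le_one e))))

omit [LinearOrder R] [IsStrictOrderedRing R] in
/-- Swapping the roots swaps the two events of the Rao–Blackwell sum. -/
lemma rbSum_swap (X Y : Set (Config E)) :
    RBRoot.rbSum p ends t s w X Y = RBRoot.rbSum p ends s t w Y X := by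
  unfold RBRoot.rbSum
  refine Finset.sum_congr rfl fun A _ => ?_
  rw [RBRoot.compl_connEvent_comm ends t s, mul_comm]

/-- **The edge to the other root can be removed — (RB-cross)**: `cross_of_update` with the roots
renamed (the Rao–Blackwell sum is symmetric in its events, `Q` in its roots). -/
theorem cross_of_update_t (hp : IsProbVec p) {o b : V} (hends : ends e = s(w, t))
    (h0 : RBRoot.rbSum (Function.update p e 0) ends s t w (connEvent ends b s) (connEvent ends o t) ≤
      prob (Function.update p e 0) ((connEvent ends s t)ᶜ ∩ connEvent ends b s) *
        prob (Function.update p e 0) ((connEvent ends s t)ᶜ ∩ connEvent ends o t) /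
        prob (Function.update p e 0) (connEvent ends s t)ᶜ) :
    RBRoot.rbSum p ends s t w (connEvent ends b s) (connEvent ends o t) ≤
      prob p ((connEvent ends s t)ᶜ ∩ connEvent ends b s) *
        prob p ((connEvent ends s t)ᶜ ∩ connEvent ends o t) / prob p (connEvent ends s t)ᶜ := by
  have key := cross_of_update ends hp (s := t) (t := s) (w := w) (o := b) (b := o) hends
  rw [rbSum_swap (p := Function.update p e 0) ends s t w, rbSum_swap (p := p) ends s t w,
    RBRoot.compl_connEvent_comm ends t s] at key
  have h := key (by rw [mul_comm]; exact h0)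
  rw [mul_comm] at h
  exact h

end TEdge

end RBRootEdge

end Summit.Ventures.PercRepro2
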